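import Summits.SmoothPoincare4.SmoothPoincare4.Theses.ConvexBisection
import Summits.SmoothPoincare4.SmoothPoincare4.Theorems.ContractibleTwistedDoubleStandard.Negative.DoubleBisection
import Summits.SmoothPoincare4.SmoothPoincare4.Theorems.ConvexBisectionContractibleTwistedDoubleStandardStubSeam
import Literature.Geometry.Symplectic.BoundaryContactomorphism
import Literature.Topology.FourManifolds.Corks
import Literature.Topology.FourManifolds.CerfGammaFourProofs
import Literature.Topology.FourManifolds.Morse
import Literature.Topology.FourManifolds.Handles
import Mathlib.Topology.Homotopy.Contractible
import HarnessLib.Audit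

/-!
# Line `legendrian-r-knot-rigidity` — skeleton for crux `ConvexBisection.ContractibleTwistedDoubleStandard`
(item stmt-SmoothPoincare4-3546, route route-SmoothPoincare4-ConvexBisection; crux-plan, round 1)

Idea card `Cruxes/ContractibleTwistedDoubleStandard/Ideas/legendrian-r-knot-rigidity.md` (ideator 1; triage
r1-1/2/3: **pass ×3**, sharpenings acted on below).  The crux: a closed smooth 4-manifold `X` which is a
Stein bisection `X = e₁(W₁) ∪ e₂(W₂)` of two compact CONTRACTIBLE Stein domains along a common contact
seam (complex tangencies pushed forward to the same plane field) is `S⁴`.  Write `ψ := e₂⁻¹ ∘ e₁|∂W₁`,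
a contactomorphism `(∂W₁, ξ_{J₁}) → (∂W₂, ξ_{J₂})`, so that `X = W₁ ∪_ψ W̄₂`.

## The line (card, sharpened by triage r1-3 (1)) and how it is typed here

CARD: in the Mazur sector the whole 4-dimensional content of `ψ` is ONE framed Legendrian knot
`κ = ψ⁻¹(Λ₂) ⊂ (∂W₁, ξ₁)` (`Λ₂` = belt circle / Legendrian push-off of `W₂`'s 2-handle, an R-knot:
contact `(+1)`-surgery gives `(S¹×S², ξ_std)`, DGS cancellation); CONTACT KIRBY–MELVIN `CKM'` (R-knots of a
Stein-filled contact `ℤHS³` are unique up to diffeomorphisms of `∂W` that EXTEND over the filling `W`,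
triage r1-3 sharpening (1)) + the Hayden–Mark–Piccirillo marking transfer (a diffeomorphism of Mazur
boundaries matching framed belt circles extends, Laudenbach–Poénaru) give `Φ : W₁ ≅ W₂` extending `ψ`,
hence `X ≅ D(W₁)` (MarkedReduction) `≅ S⁴` (Mazur 1961).

TYPING: contact `(±1)`-surgery is not in the tree, so the R-knot itself cannot be a binder; but in its
filling-certified form (`κ = ψ⁻¹(belt knot of another Mazur-type Stein filling)`, which for ONE 1-handle is
equivalent to the R-property: a one-relator homology ball is contractible) the conjunction
`CKM' ∧ marking-transfer` is EQUIVALENT, on the Mazur sector, to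

  **RCR** — every contactomorphism between the boundaries of two contractible (Mazur-type) Stein domains
  extends to a diffeomorphism of the domains

(⇒: `κ := ψ⁻¹(Λ₂)`; CKM' gives `h ∈ Diff_ext(W₁)|∂` with `h(Λ₁) = κ` framed; `ψ ∘ h` matches belt circles so
extends to `Φ`; `ψ = Φ|∂ ∘ h⁻¹` extends.  ⇐: restrict RCR to `κ` of the form `χ(Λ₁)`, `χ ∈ Cont(ξ₁)`.)  RCR
splits EXACTLY into the two bets below, each with its own literature and its own cheapest falsifier:
`stub_fillingUniqueness` (SOME contactomorphism extends `W₁ → W₂`: exotic Stein Mazur pairs à la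
Hayden–Mark–Piccirillo 1908.05269 §6 / Akbulut–Yildiz 1901.00806 Thm 1 must induce NON-contactomorphic
boundaries) and `stub_contactChirality` (EVERY contactomorphism of `(∂W, ξ_J)` extends over `W`, i.e. no cork
twist of a Stein cork is a contactomorphism of its Stein-induced contact structure — Akbulut–Karakurt
1104.2247 Thm 4.1 confirm this for the Akbulut cork with its Legendrian-handlebody structure; UNDECIDED for
Ukida's planar structure `ξ₂`: triage F0, the cheapest falsifier).  Both are typed over existing
declarations (`SteinStructure`, `contactPlane`, `BoundaryData`, `ExtendsToDiffeomorph` = the cork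
vocabulary of `Corks.lean`, `Diffeomorph`) through the local predicate `IsContacto` (a map of abstract
boundaries is a contactomorphism iff its differential carries the pulled-back complex tangencies to each
other).  The crux quantifies over ALL contractible Stein halves, not only Mazur-type ones, so RCR is
filed at that generality (the R-LINK version of CKM is its engine beyond one 1-handle), and the doubles
residual that every line on this crux concedes (triage cross-card note; disprover's
`double_standard_of_crux`, landed) is filed openly: `stub_doubleIsPresentationSphere` (TRUE, L: the double
of a contractible compact Stein domain is a homotopy 4-sphere bounding the contractible 5-dimensional
2-handlebody `W × I`, Eliashberg's handle theorem) and `stub_presentationSpheres`, whose statement is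
VERBATIM the route item `EntropyLadder.PresentationSpheresStandard` (stmt-SmoothPoincare4-3717, wanted by
three routes) — on the Mazur sector it is Mazur's theorem `W × I ≅ B⁵`.

## Stubs (5) and glue

* `stub_seam` (L; folklore, Lean-heavy; shared by every line on this crux) — the seam map
  `ψ = e₂⁻¹ ∘ e₁|∂` is a diffeomorphism of the abstract boundaries intertwining `e₁, e₂` and a
  contactomorphism (`IsContacto`), for ANY boundary data; uses only the two embeddings, the two seam
  equations and the tangency matching (not the cover, not contractibility).
* `stub_fillingUniqueness` (XL; BET 1) — contractible compact Stein domains with contactomorphic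
  boundaries are diffeomorphic BY a diffeomorphism restricting to a contactomorphism.
* `stub_contactChirality` (XL; BET 2, the card's CKM' + marking lemma on the Mazur sector) — every
  contactomorphism of `(∂W, ξ_J)`, `W` contractible compact Stein, `ExtendsToDiffeomorph`.
* `stub_doubleIsPresentationSphere` (L; known) — `IsDouble b (𝓡 4) P`, `W` contractible compact Stein ⇒
  `P ≃ₕ S⁴` and `P` bounds a compact contractible 5-manifold with an adapted Morse function of index `≤ 2`.
* `stub_presentationSpheres` (open problem; = stmt-3717 verbatim) — such `P` are `S⁴`.
* Glue PROVED here (sorry-free): `IsContacto.symm`, `IsContacto.trans` (chain rule),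
  `isDouble_of_extension` (= the card's first lemma MarkedReduction: an extension `Φ` of `ψ` makes `X` a
  double of `W₁` — re-embed `W₂` through `Φ`; uses the COVER hypothesis), and the composition
  `ContractibleTwistedDoubleStandard_of`, which concludes the crux BY NAME:
  seam `ψ` ↦ (`ψ₀, Φ₀`) by BET 1 ↦ `χ = ψ₀⁻¹ψ ∈ Cont(∂W₁, ξ₁)` extends by BET 2 to `Φ₁` ↦ `Φ = Φ₀Φ₁`
  extends `ψ` ↦ `X` is a double of `W₁` ↦ presentation sphere ↦ `S⁴`.

## Disproof / Negative obligations honoured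

`payload.disproof_path` (run/gate/evidence/…/20260815T234520Z-Disproof.lean, v7) is NOT mounted in this jail and
`ledger crux cat … Disproof.lean` has no workfile; its content is taken from the item's evidence notes v1–v7
and the LANDED `Theorems/ContractibleTwistedDoubleStandard/Negative/{DoubleBisection,LoadBearing,SphereAcyclicBisection}.lean`
(imported: `DoubleBisection`).  (i) `not_crux_without_cover` (LoadBearing §4, witness `S⁴ ⊔ S⁴`): the cover
`range e₁ ∪ range e₂ = univ` is used — at `isDouble_of_extension` (range of the re-embedded half).  (ii)
`not_crux_without_contractible` (empty bisection): contractibility is a hypothesis of BET 1, BET 2 and of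
both doubles stubs (false without it: `D(S¹×B³) = S¹×S³`; Stein rational balls).  (iii)
`double_standard_of_crux` / `steinBisection_of_isDouble` (DoubleBisection §3): the doubles residual is FORCED
on any proof of the crux — it is filed as the two last stubs, not hidden (`doublesSector_forced` below
re-derives it from them without the crux).  (iv) Disproof §5(i) (Akbulut–Karakurt: `τ` is not a
contactomorphism of handlebody-type `ξ`) is an INSTANCE of BET 2, not a counterexample; F0 (planar `ξ₂`)
is BET 2's first open instance.  `ledger negatives --problem SmoothPoincare4`: 0 refuted statements.  No
stub restates the crux (BET 1/2 are statements about halves and are NOT implied by SPC4; the last stub is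
another route's crux, by design), the summit, or a refuted statement.
-/

noncomputable section

set_option linter.dupNamespace false

open scoped Manifold ContDiff Topology ContinuousMap
open Set Function Literature.Geometry.Symplectic Literature.Topology.FourManifolds

namespace Summit.SmoothPoincare4.SmoothPoincare4.Cruxes.ContractibleTwistedDoubleStandard.LegendrianRKnotRigidity

open Summit.SmoothPoincare4.SmoothPoincare4.Theses.ConvexBisection

/-! ### The contactomorphism predicate on abstract boundaries

`IsContacto J₁ J₂ b₁ b₂ ψ` and its groupoid lemmas `IsContacto.refl/symm/trans` now live in
`Literature.Geometry.Symplectic.BoundaryContactomorphism` (landed p72812, lead reshape r1). -/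

/-! ### MarkedReduction: an extension of the seam map makes `X` a double (glue, proved) -/

section MarkedDouble

variable {X : Type*} [TopologicalSpace X] [ChartedSpace (EuclideanSpace ℝ (Fin 4)) X]
  {W₁ : Type} [TopologicalSpace W₁] [ChartedSpace (EuclideanHalfSpace 4) W₁] [IsManifold (𝓡∂ 4) ∞ W₁]
  {W₂ : Type} [TopologicalSpace W₂] [ChartedSpace (EuclideanHalfSpace 4) W₂] [IsManifold (𝓡∂ 4) ∞ W₂]
  {e₁ : W₁ → X} {e₂ : W₂ → X}

/-- **MarkedReduction (the card's first lemma, proved).**  In the situation of the crux (two smooth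
embeddings covering `X` and meeting exactly along `e₁(∂W₁)`), if the seam map `ψ : ∂W₁ → ∂W₂`
(`e₂ ∘ incl₂ ∘ ψ = e₁ ∘ incl₁`) is the restriction of a diffeomorphism `Φ : W₁ ≅ W₂`
(`Φ ∘ incl₁ = incl₂ ∘ ψ`), then `X` is the double `W₁ ∪_{id} W₁`: re-embed the second half as `e₂ ∘ Φ`
(a smooth embedding, `Manifold.IsSmoothEmbedding.comp_diffeomorph`) — the two copies of `W₁` still cover `X`
(here the COVER hypothesis of the crux is used) and meet exactly in `incl₁ z ↔ incl₁ z`.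
Milnor, *Lectures on the h-cobordism theorem* (1965), §9; Hayden–Mark–Piccirillo arXiv:1908.05269,
proof of Cor. 1.3 (the 4-dimensional half of the marking transfer). [folklore] -/
theorem isDouble_of_extension
    (h₁ : Manifold.IsSmoothEmbedding (𝓡∂ 4) (𝓡 4) ∞ e₁) (h₂ : Manifold.IsSmoothEmbedding (𝓡∂ 4) (𝓡 4) ∞ e₂)
    (hU : range e₁ ∪ range e₂ = univ) (hI : range e₁ ∩ range e₂ = e₁ '' (𝓡∂ 4).boundary W₁)
    (b₁ : BoundaryData (𝓡∂ 4) W₁ (𝓡 3)) (b₂ : BoundaryData (𝓡∂ 4) W₂ (𝓡 3))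
    (ψ : b₁.carrier → b₂.carrier) (hψ : ∀ z, e₂ (b₂.incl (ψ z)) = e₁ (b₁.incl z))
    (Φ : W₁ ≃ₘ⟮𝓡∂ 4, 𝓡∂ 4⟯ W₂) (hΦ : ∀ z, Φ (b₁.incl z) = b₂.incl (ψ z)) :
    IsDouble b₁ (𝓡 4) X := by
  refine ⟨e₁, e₂ ∘ ⇑Φ, h₁, h₂.comp_diffeomorph Φ, ?_, ?_⟩
  · rw [(EquivLike.surjective Φ).range_comp]
    exact hU
  · intro a a'
    constructor
    · intro hab
      have hmem : e₁ a ∈ range e₁ ∩ range e₂ := ⟨mem_range_self a, Φ a', hab.symm⟩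
      rw [hI] at hmem
      obtain ⟨w, hw, hwa⟩ := hmem
      obtain rfl : w = a := h₁.isEmbedding.injective hwa
      rw [← b₁.range_incl] at hw
      obtain ⟨z, rfl⟩ := hw
      refine ⟨z, rfl, Φ.injective ?_⟩
      show Φ a' = Φ (b₁.incl z)
      rw [hΦ]
      apply h₂.isEmbedding.injective
      show e₂ (Φ a') = e₂ (b₂.incl (ψ z))
      rw [hψ]
      exact hab.symm
    · rintro ⟨z, rfl, rfl⟩
      show e₁ (b₁.incl z) = e₂ (Φ (b₁.incl z))
      rw [hΦ, hψ]

end MarkedDouble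

/-! ### The five stubs -/

/-- **Stub 1 — the seam contactomorphism (L; folklore, Lean-heavy; shared by all lines).**  For two
compact Stein domains smoothly embedded in a 4-manifold `X` so that the images meet exactly along the
images of BOTH boundaries, with complex tangencies pushed forward to the same planes at common points,
and for any boundary data `b₁`, `b₂`: the seam map `ψ = incl₂⁻¹ ∘ e₂⁻¹ ∘ e₁ ∘ incl₁` is a diffeomorphism
`∂W₁ ≅ ∂W₂` of the abstract boundaries (the two boundaries are embedded 3-submanifolds of `X` with the same
underlying set, and an embedded submanifold structure is unique) and a contactomorphism (`IsContacto`: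
from the matching clause and injectivity of `de₂`).  Why plausible: standard differential topology
(Lee, *Introduction to Smooth Manifolds* (2013), Thm 5.31 uniqueness of embedded submanifold structures;
Geiges (2008), §2.1).  Neither the cover nor contractibility is used.  Helpers landed for the prover:
`Negative.DoubleBisection.mfderiv_apply_mem_boundaryTangentSpace` (A1), `exists_mfderiv_incl_eq` (A2). -/
theorem stub_seam :
    ∀ (X : Type) [TopologicalSpace X] [T2Space X] [SecondCountableTopology X] [CompactSpace X]
      [ChartedSpace (EuclideanSpace ℝ (Fin 4)) X] [IsManifold (𝓡 4) ∞ X]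
      (W₁ : Type) [TopologicalSpace W₁] [ChartedSpace (EuclideanHalfSpace 4) W₁] [IsManifold (𝓡∂ 4) ∞ W₁]
      [CompactSpace W₁]
      (W₂ : Type) [TopologicalSpace W₂] [ChartedSpace (EuclideanHalfSpace 4) W₂] [IsManifold (𝓡∂ 4) ∞ W₂]
      [CompactSpace W₂]
      (J₁ : SteinStructure W₁) (J₂ : SteinStructure W₂) (e₁ : W₁ → X) (e₂ : W₂ → X),
      Manifold.IsSmoothEmbedding (𝓡∂ 4) (𝓡 4) ∞ e₁ → Manifold.IsSmoothEmbedding (𝓡∂ 4) (𝓡 4) ∞ e₂ →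
      range e₁ ∩ range e₂ = e₁ '' (𝓡∂ 4).boundary W₁ →
      range e₁ ∩ range e₂ = e₂ '' (𝓡∂ 4).boundary W₂ →
      (∀ w₁ w₂, e₁ w₁ = e₂ w₂ →
        Submodule.map (mfderiv (𝓡∂ 4) (𝓡 4) e₁ w₁).toLinearMap (contactPlane J₁.J w₁) =
          Submodule.map (mfderiv (𝓡∂ 4) (𝓡 4) e₂ w₂).toLinearMap (contactPlane J₂.J w₂)) →
      ∀ (b₁ : BoundaryData (𝓡∂ 4) W₁ (𝓡 3)) (b₂ : BoundaryData (𝓡∂ 4) W₂ (𝓡 3)),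
        ∃ ψ : b₁.carrier ≃ₘ⟮𝓡 3, 𝓡 3⟯ b₂.carrier,
          (∀ z, e₂ (b₂.incl (ψ z)) = e₁ (b₁.incl z)) ∧ IsContacto J₁ J₂ b₁ b₂ ψ :=
  -- LANDED p73294 (wave 1): `Theorems/ConvexBisectionContractibleTwistedDoubleStandardStubSeam.lean`
  Summit.SmoothPoincare4.SmoothPoincare4.Theorems.ContractibleTwistedDoubleStandard.LegendrianRKnotRigidity.stub_seam

/-- **Stub 2 — BET 1: marked uniqueness of contractible Stein fillings (XL).**  Two contractible compact
Stein domains whose Stein-induced contact boundaries are contactomorphic are diffeomorphic BY a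
diffeomorphism `Φ : W₁ ≅ W₂` whose boundary restriction `ψ₀` is itself a contactomorphism.  Mazur
sector: CKM' + Hayden–Mark–Piccirillo marking transfer (module docstring: even every `ψ` extends).  Known
at the seam `S³`: Eliashberg 1990 Thm 5.1 (`W₁ ≅ W₂ ≅ B⁴`, tree fact
`Eliashberg1990_steinFilling_sphere_three`) + Cerf.  Why it might fail: an exotic pair of contractible
Stein fillings of ONE contact `ℤHS³` kills it — candidates: Hayden–Mark–Piccirillo arXiv:1908.05269 §6 /
Prop 2.2 and Akbulut–Yildiz arXiv:1901.00806 Thm 1 (exotic Stein Mazur pairs with a common boundary;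
whether their induced contact structures agree is uncomputed: `c(ξ_W) = x_W` vs `c(ξ_{W'})` in
`HF^(−Y)` modulo `Mod(Y)`, SnapPy/bordered HF).  Not implied by SPC4.  CONTRACTIBILITY IS ESSENTIAL: for
a Stein surface of general type (a fake-projective-plane-like ball quotient, `b₁ > 0`) Iida arXiv:2608.09361
Thm 1.8 + Rmk 10.2 gives two Stein structures with contactomorphic boundaries such that NO boundary
contactomorphism is isotopic to the restriction of a diffeomorphism of the filling; his Question 10.5
(a simply connected such example) is open — this stub and the next assert the negative answer for
contractible fillings.  Degenerate corner recorded on the line card: `W₂ = W̄₁` with both orientations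
Stein and an orientation-reversing contactomorphism. -/
theorem stub_fillingUniqueness :
    ∀ (W₁ : Type) [TopologicalSpace W₁] [T2Space W₁] [SecondCountableTopology W₁]
      [ChartedSpace (EuclideanHalfSpace 4) W₁] [IsManifold (𝓡∂ 4) ∞ W₁] [CompactSpace W₁]
      [ContractibleSpace W₁]
      (W₂ : Type) [TopologicalSpace W₂] [T2Space W₂] [SecondCountableTopology W₂]
      [ChartedSpace (EuclideanHalfSpace 4) W₂] [IsManifold (𝓡∂ 4) ∞ W₂] [CompactSpace W₂]
      [ContractibleSpace W₂]
      (J₁ : SteinStructure W₁) (J₂ : SteinStructure W₂)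
      (b₁ : BoundaryData (𝓡∂ 4) W₁ (𝓡 3)) (b₂ : BoundaryData (𝓡∂ 4) W₂ (𝓡 3))
      (ψ : b₁.carrier ≃ₘ⟮𝓡 3, 𝓡 3⟯ b₂.carrier), IsContacto J₁ J₂ b₁ b₂ ψ →
      ∃ (ψ₀ : b₁.carrier ≃ₘ⟮𝓡 3, 𝓡 3⟯ b₂.carrier) (Φ : W₁ ≃ₘ⟮𝓡∂ 4, 𝓡∂ 4⟯ W₂),
        IsContacto J₁ J₂ b₁ b₂ ψ₀ ∧ ∀ z, Φ (b₁.incl z) = b₂.incl (ψ₀ z) := by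
  sorry

/-- **Stub 3 — BET 2: contact chirality of Stein corks (XL; the card's lever).**  Every contactomorphism
`χ` of the Stein-induced contact structure `(∂W, ξ_J)` of a contractible compact Stein domain `W` extends
to a self-diffeomorphism of `W` (`ExtendsToDiffeomorph`, Akbulut's cork vocabulary): a cork twist of a
Stein cork is never a contactomorphism of `ξ_J`, not even up to isotopy (Gray).  MAZUR SECTOR = the card:
`χ(Λ)` is a Legendrian R-knot of `(∂W, ξ_J)` (DGS naturality, arXiv:math/0307237 Lemma 1.1); CONTACT
KIRBY–MELVIN CKM' (R-knots unique up to `Diff_ext(W)|∂`, triage r1-3 (1); base case `(S³, ξ_std)`: the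
`tb = −1` unknot, Gabai Property R — tree `isUnknot_of_isIntegralSurgery_zero_of_gabai` — + Eliashberg–Fraser
arXiv:0801.2553) gives `h` extending with `h(Λ) = χ(Λ)` framed; `h⁻¹χ` fixes the framed belt circle, hence
extends (Hayden–Mark–Piccirillo 1908.05269 proof of Cor 1.3: induced diffeo of the surgered `S¹×S²`
extends over `S¹×B³`, Laudenbach–Poénaru — tree `laudenbachPoenaru_…_holds`); so `χ` extends.  Evidence:
Akbulut–Karakurt arXiv:1104.2247 Thm 4.1/Cor 4.2–4.3 (`τ` of the Akbulut cork moves `c⁺(ξ)` for the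
Legendrian-handlebody structure — an instance); `W = B⁴`: Cerf `Γ₄ = 0`.  Why it might fail / cheapest
falsifier (triage F0, shared with 4 cards): `τ^*ξ₂ ≃ ξ₂` for Ukida's PLANAR Stein structure on the Akbulut
cork (KOU arXiv:1607.07661 Prop 2.3) — HF-blind (`c⁺(ξ₂)` is the tower generator), decidable as a Hurwitz
orbit problem for `t_a t_b t_c t_{d₁}` in `Mod(P₅, ∂)` (Wendl); a YES refutes this stub (not the crux).
The non-contractible analogue is FALSE (Iida arXiv:2608.09361 Rmk 10.2, `b₁ > 0`), so any proof must use
contractibility (e.g. through Freedman: `χ` extends to a homeomorphism; through `∂W` being a `ℤHS³`). -/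
theorem stub_contactChirality :
    ∀ (W : Type) [TopologicalSpace W] [T2Space W] [SecondCountableTopology W]
      [ChartedSpace (EuclideanHalfSpace 4) W] [IsManifold (𝓡∂ 4) ∞ W] [CompactSpace W]
      [ContractibleSpace W]
      (J : SteinStructure W) (b : BoundaryData (𝓡∂ 4) W (𝓡 3))
      (χ : b.carrier ≃ₘ⟮𝓡 3, 𝓡 3⟯ b.carrier), IsContacto J J b b χ → ExtendsToDiffeomorph b χ := by
  sorry

/-- **Stub 4a — the double of a compact contractible 4-manifold is a homotopy 4-sphere (L; KNOWN,
provable now — wave 1 produced the proof).**  For a compact contractible (Hausdorff, second countable)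
smooth 4-manifold with boundary `W`, a boundary datum `b`, and a Hausdorff charted space `P` which is a
double of `W` (`IsDouble b (𝓡 4) P`), `P ≃ₕ S⁴`: `P` is compact; `∂W` is connected (Lefschetz duality
mod 2); with a collar the two copies form a `BoundaryCollar.DoubleData`, so `P` is simply connected
(van Kampen) and `H₂(P; ℤ) ≅ H₁(∂W; ℤ) = 0` (Mayer–Vietoris, Alexander duality); conclude by the PROVED
recognition theorem `nonempty_homotopyEquiv_sphere_four_iff_holds` (Freedman–Quinn 1990 §10.1).  No
Stein structure is needed.  Kervaire–Milnor 1963 Lemma 2.3; Hatcher 2002 §2.2, Thm. 3.43. -/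
theorem stub_doubleIsHomotopySphere :
    ∀ (W : Type) [TopologicalSpace W] [T2Space W] [SecondCountableTopology W]
      [ChartedSpace (EuclideanHalfSpace 4) W] [IsManifold (𝓡∂ 4) ∞ W] [CompactSpace W]
      [ContractibleSpace W] (b : BoundaryData (𝓡∂ 4) W (𝓡 3))
      (P : Type) [TopologicalSpace P] [T2Space P] [ChartedSpace (EuclideanSpace ℝ (Fin 4)) P],
      IsDouble b (𝓡 4) P →
      Nonempty (P ≃ₕ Metric.sphere (0 : EuclideanSpace ℝ (Fin 5)) 1) := by
  sorry

/-- **Stub 4b — Eliashberg–Gompf: a compact Stein domain is a 2-handlebody (NAMED-FACT DEBT; known,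
to be discharged in Literature).**  Gompf, *Handlebody construction of Stein surfaces* (1998), Thm. 1.3
(Eliashberg 1990), compact case, "only if", condition (a): a compact (Hausdorff, second countable)
`C^∞` 4-manifold with boundary admitting a Stein structure (`IsSteinDomain W`) carries a Morse function
adapted to `∂W` all of whose critical points have index `≤ 2` (`IsHandlebodyOfIndexLE 3 2 W`): a
generic `J`-convex function is Morse, J-convexity is `C²`-open, and a `J`-convex Morse function on a
complex surface has no critical point of index `> 2`; rescale so that `∂W = {φ = max φ}` becomes the
level `1`.  VERBATIM the body of the named fact `Literature.Geometry.Symplectic.Gompf1998_thm13_indexLE_two`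
proposed to `Literature/Geometry/Symplectic/SteinHandlebodies.lean` (lead, wave-1 integration); a
discharge `…_holds` there closes this stub by `exact`.  Estimated 600–1000 lines over
`CobordismMorseFunctions.exists_isMorse_of_boundaryRegular` + the Levi-form identity `levi_apply_self_J_eq`. -/
theorem stub_steinTwoHandlebody :
    ∀ (W : Type) [TopologicalSpace W] [T2Space W] [SecondCountableTopology W] [CompactSpace W]
      [ChartedSpace (EuclideanHalfSpace 4) W] [IsManifold (𝓡∂ 4) ∞ W],
      IsSteinDomain W → IsHandlebodyOfIndexLE 3 2 W := by
  sorry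

/-- **Stub 4c — the double bounds the thickening `W × [0, 1]`, a handlebody of the same indices
(NAMED-FACT DEBT; known, to be discharged in Literature).**  For a compact smooth `(n+1)`-manifold with
boundary `W` with boundary datum `b` and a Hausdorff second-countable smooth `(n+1)`-manifold `P` which
is a double of `W` (`IsDouble b (𝓡 (n + 1)) P`), there is a compact Hausdorff second-countable smooth
`(n+2)`-manifold with boundary `V` (= `W × [0, 1]` with its corners `∂W × {0, 1}` straightened),
homotopy equivalent to `W`, which is a `k`-handlebody when `W` is a `k`-handlebody (`hⁱ × I` is an
`i`-handle; the witness may depend on the given handle structure — lead reshape r1b), with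
a smooth embedding `P → V` onto `∂V` (`∂(W × I) = W × {0} ∪ ∂W × I ∪ W × {1} = D W`).  Kosinski 1993
VI §5; Kirby 1989 Ch. I §2 and p. 18; Freedman–Gompf–Morrison–Walker 2010, proof of Fact 2; Milnor 1965
§3.  VERBATIM the body of the named fact `Literature.Topology.FourManifolds.exists_thickening_of_isDouble`
proposed to `Literature/Topology/FourManifolds/DoubleThickening.lean` (lead, wave-1 integration); absent
from the tree (no products with corners); estimated 1000+ lines. -/
theorem stub_doubleThickening :
    ∀ (n k : ℕ) (W : Type) [TopologicalSpace W] [T2Space W] [SecondCountableTopology W]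
      [ChartedSpace (EuclideanHalfSpace (n + 1)) W] [IsManifold (𝓡∂ (n + 1)) ∞ W] [CompactSpace W],
      IsHandlebodyOfIndexLE n k W →
      ∀ (b : BoundaryData (𝓡∂ (n + 1)) W (𝓡 n))
        (P : Type) [TopologicalSpace P] [T2Space P] [SecondCountableTopology P]
        [ChartedSpace (EuclideanSpace ℝ (Fin (n + 1))) P] [IsManifold (𝓡 (n + 1)) ∞ P],
      IsDouble b (𝓡 (n + 1)) P →
      ∃ (V : Type) (_ : TopologicalSpace V) (_ : T2Space V) (_ : SecondCountableTopology V)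
        (_ : ChartedSpace (EuclideanHalfSpace (n + 1 + 1)) V)
        (_ : IsManifold (𝓡∂ (n + 1 + 1)) ∞ V) (_ : CompactSpace V),
        Nonempty (V ≃ₕ W) ∧ IsHandlebodyOfIndexLE (n + 1) k V ∧
        ∃ φ : P → V, Manifold.IsSmoothEmbedding (𝓡 (n + 1)) (𝓡∂ (n + 1 + 1)) ∞ φ ∧
          Set.range φ = (𝓡∂ (n + 1 + 1)).boundary V := by
  sorry

/-- **Doubles of contractible Stein domains are presentation spheres (glue, proved from Stubs 4a–4c;
wave-1 worker proof).**  If `P` is a (Hausdorff, second countable) double `W ∪_{id} W` of a contractible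
compact Stein domain `W`, then `P ≃ₕ S⁴` (Stub 4a) and `P` bounds a compact contractible smooth
5-manifold admitting a Morse function adapted to the boundary with all critical points of index `≤ 2`:
`V = W × I` (Stub 4c) is contractible since `V ≃ₕ W`, and a 2-handlebody since `W` is (Stub 4b).  The
conclusion is, verbatim, the hypothesis of `stub_presentationSpheres`.  (The numerals `3 + 1 + 1` and
`4 + 1` agree by `rfl`; the Morse index is transported along a reducible `rfl` in small steps.)
Gompf 1998 Thm. 1.3; Freedman–Gompf–Morrison–Walker 2010, proof of Fact 2. [folklore] -/
theorem doubleIsPresentationSphere :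
    ∀ (W : Type) [TopologicalSpace W] [T2Space W] [SecondCountableTopology W]
      [ChartedSpace (EuclideanHalfSpace 4) W] [IsManifold (𝓡∂ 4) ∞ W] [CompactSpace W]
      [ContractibleSpace W]
      (J : SteinStructure W) (b : BoundaryData (𝓡∂ 4) W (𝓡 3))
      (P : Type) [TopologicalSpace P] [T2Space P] [SecondCountableTopology P]
      [ChartedSpace (EuclideanSpace ℝ (Fin 4)) P] [IsManifold (𝓡 4) ∞ P],
      IsDouble b (𝓡 4) P →
      Nonempty (P ≃ₕ Metric.sphere (0 : EuclideanSpace ℝ (Fin 5)) 1) ∧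
      ∃ (V : Type) (_ : TopologicalSpace V) (_ : T2Space V) (_ : SecondCountableTopology V)
        (_ : ChartedSpace (EuclideanHalfSpace (4 + 1)) V) (_ : IsManifold (𝓡∂ (4 + 1)) ∞ V)
        (_ : CompactSpace V), ContractibleSpace V ∧
        (∃ f : V → ℝ, Literature.Topology.FourManifolds.IsMorseAdapted (𝓡∂ (4 + 1)) f ∧
          ∀ z, Literature.Topology.FourManifolds.IsMCriticalPt (𝓡∂ (4 + 1)) f z →
            Literature.Topology.FourManifolds.morseIndex (𝓡∂ (4 + 1)) f z ≤ 2) ∧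
        ∃ φ : P → V, Manifold.IsSmoothEmbedding (𝓡 4) (𝓡∂ (4 + 1)) ∞ φ ∧
          Set.range φ = (𝓡∂ (4 + 1)).boundary V := by
  intro W _ _ _ _ _ _ _ J b P _ _ _ _ _ hD
  refine ⟨stub_doubleIsHomotopySphere W b P hD, ?_⟩
  -- `W` is a 2-handlebody (Eliashberg–Gompf, Stub 4b)
  have hW : IsHandlebodyOfIndexLE 3 2 W := stub_steinTwoHandlebody W ⟨J⟩
  -- `V = W × I`, `∂V = P` (Stub 4c)
  obtain ⟨V, _, _, _, _, _, _, ⟨e⟩, hV, φ, hφ, hrange⟩ := stub_doubleThickening 3 2 W hW b P hD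
  haveI : ContractibleSpace V := e.contractibleSpace
  refine ⟨V, ‹_›, ‹_›, ‹_›, ‹_›, ‹_›, ‹_›, inferInstance, ?_, ?_⟩
  · obtain ⟨f, hf, hind⟩ := hV
    refine ⟨f, ?_, ?_⟩
    · exact hf
    · intro z hz
      have hz' : IsMCriticalPt (𝓡∂ (3 + 1 + 1)) f z := hz
      have h2 : morseIndex (𝓡∂ (3 + 1 + 1)) f z ≤ 2 := hind z hz'
      have h3 : morseIndex (𝓡∂ (4 + 1)) f z = morseIndex (𝓡∂ (3 + 1 + 1)) f z := by
        with_reducible rfl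
      exact h3.trans_le h2
  · exact ⟨φ, hφ, hrange⟩

/-- **Stub 5 — presentation 4-spheres are standard (open problem; the shared doubles residual).**
VERBATIM the statement of the route item `Summit.SmoothPoincare4.SmoothPoincare4.Theses.EntropyLadder.PresentationSpheresStandard`
(stmt-SmoothPoincare4-3717; also `ConvexityLadder.`/`RicciTranscript.PresentationSpheresStandard`): a
homotopy 4-sphere bounding a compact contractible smooth 5-manifold with an adapted Morse function all of
whose critical points have index `≤ 2` (`= H⁵(𝒫, ε)` for a balanced presentation of the trivial group) is
diffeomorphic to `S⁴`.  Known: `𝒫` Andrews–Curtis trivial (Andrews–Curtis 1965; tree fact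
`IsPresentationHandlebodyFive.nonempty_diffeomorph_closedBall_of_isStablyAndrewsCurtisEquivalent`) — in
particular the MAZUR SECTOR of this line (one 1-handle, one 2-handle, `π₁ = 1` ⇒ the relator is AC-trivial;
Mazur 1961: `W × I ≅ B⁵`); the Akbulut–Kirby/Gompf family (Gompf 1991).  Why it might fail: it is the
5-dimensional Andrews–Curtis problem (Kirby 5.2); an exotic `Σ(𝒫, ε)` refutes it AND the crux
(`Negative.DoubleBisection.double_standard_of_crux`).  Stated verbatim rather than imported so that this
file does not depend on another route's gate-rewritten file; a proof of stmt-3717 discharges it by `exact`. -/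
theorem stub_presentationSpheres :
    ∀ (M : Type) [TopologicalSpace M] [T2Space M] [SecondCountableTopology M]
      [ChartedSpace (EuclideanSpace ℝ (Fin 4)) M] [IsManifold (𝓡 4) ∞ M],
      M ≃ₕ Metric.sphere (0 : EuclideanSpace ℝ (Fin 5)) 1 →
      (∃ (W : Type) (_ : TopologicalSpace W) (_ : T2Space W) (_ : SecondCountableTopology W)
        (_ : ChartedSpace (EuclideanHalfSpace (4 + 1)) W) (_ : IsManifold (𝓡∂ (4 + 1)) ∞ W)
        (_ : CompactSpace W), ContractibleSpace W ∧
        (∃ f : W → ℝ, Literature.Topology.FourManifolds.IsMorseAdapted (𝓡∂ (4 + 1)) f ∧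
          ∀ z, Literature.Topology.FourManifolds.IsMCriticalPt (𝓡∂ (4 + 1)) f z →
            Literature.Topology.FourManifolds.morseIndex (𝓡∂ (4 + 1)) f z ≤ 2) ∧
        ∃ φ : M → W, Manifold.IsSmoothEmbedding (𝓡 4) (𝓡∂ (4 + 1)) ∞ φ ∧
          Set.range φ = (𝓡∂ (4 + 1)).boundary W) →
      Nonempty (M ≃ₘ⟮𝓡 4, 𝓡 4⟯ Metric.sphere (0 : EuclideanSpace ℝ (Fin 5)) 1) := by
  sorry

/-! ### Certified remarks -/

/-- The doubles sector handled by Stubs 4–5 WITHOUT the crux: every (Hausdorff, second countable) double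
of a contractible compact Stein domain is `S⁴` — the statement the disprover derived FROM the crux
(`Negative.DoubleBisection.double_standard_of_crux`), so this residual is forced on any proof. [folklore] -/
theorem doublesSector_forced
    (W : Type) [TopologicalSpace W] [T2Space W] [SecondCountableTopology W]
    [ChartedSpace (EuclideanHalfSpace 4) W] [IsManifold (𝓡∂ 4) ∞ W] [CompactSpace W]
    [ContractibleSpace W] (J : SteinStructure W) (b : BoundaryData (𝓡∂ 4) W (𝓡 3))
    (P : Type) [TopologicalSpace P] [T2Space P] [SecondCountableTopology P]
    [ChartedSpace (EuclideanSpace ℝ (Fin 4)) P] [IsManifold (𝓡 4) ∞ P] (hD : IsDouble b (𝓡 4) P) :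
    Nonempty (P ≃ₘ⟮𝓡 4, 𝓡 4⟯ Metric.sphere (0 : EuclideanSpace ℝ (Fin 5)) 1) := by
  obtain ⟨⟨he⟩, hV⟩ := doubleIsPresentationSphere W J b P hD
  exact stub_presentationSpheres P he hV

/-! ### The composition: the five stubs prove the crux, by name -/

/-- **Skeleton theorem.**  `stub_seam`, `stub_fillingUniqueness`, `stub_contactChirality`,
`stub_doubleIsPresentationSphere`, `stub_presentationSpheres` ⟹
`ConvexBisection.ContractibleTwistedDoubleStandard` (concluded BY NAME).  Glue, all proved above: the halves
inherit `T2`/second countability from `X`; boundary data exist (`nonempty_boundaryData_holds`); the seam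
contactomorphism `ψ` (Stub 1); `(ψ₀, Φ₀)` from BET 1; `χ := ψ ; ψ₀⁻¹` is a contactomorphism of
`(∂W₁, ξ₁)` (`IsContacto.trans/symm`) hence extends to `Φ₁` (BET 2); `Φ := Φ₁ ; Φ₀` extends `ψ`; so `X`
is a double of `W₁` (`isDouble_of_extension`, uses the cover); Stubs 4–5 finish. -/
theorem ContractibleTwistedDoubleStandard_of : ContractibleTwistedDoubleStandard := by
  intro X _ _ _ _ _ _ W₁ _ _ _ _ _ W₂ _ _ _ _ _ J₁ J₂ e₁ e₂ h₁ h₂ hU hI₁ hI₂ hC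
  haveI : T2Space W₁ := h₁.isEmbedding.t2Space
  haveI : SecondCountableTopology W₁ := h₁.isEmbedding.secondCountableTopology
  haveI : T2Space W₂ := h₂.isEmbedding.t2Space
  haveI : SecondCountableTopology W₂ := h₂.isEmbedding.secondCountableTopology
  obtain ⟨b₁⟩ := nonempty_boundaryData_holds 3 W₁
  obtain ⟨b₂⟩ := nonempty_boundaryData_holds 3 W₂
  -- Stub 1: the seam contactomorphism
  obtain ⟨ψ, hψ, hc⟩ := stub_seam X W₁ W₂ J₁ J₂ e₁ e₂ h₁ h₂ hI₁ hI₂ hC b₁ b₂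
  -- BET 1: some contactomorphism extends to `Φ₀ : W₁ ≅ W₂`
  obtain ⟨ψ₀, Φ₀, hc₀, hΦ₀⟩ := stub_fillingUniqueness W₁ W₂ J₁ J₂ b₁ b₂ ψ hc
  -- BET 2: the contactomorphism `χ = ψ₀⁻¹ ∘ ψ` of `(∂W₁, ξ₁)` extends over `W₁`
  have hχ : IsContacto J₁ J₁ b₁ b₁ (ψ.trans ψ₀.symm) := hc.trans hc₀.symm
  obtain ⟨Φ₁, hΦ₁⟩ := stub_contactChirality W₁ J₁ b₁ (ψ.trans ψ₀.symm) hχ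
  -- `Φ := Φ₀ ∘ Φ₁` extends `ψ`
  have hΦ : ∀ z, (Φ₁.trans Φ₀) (b₁.incl z) = b₂.incl (ψ z) := by
    intro z
    show Φ₀ (Φ₁ (b₁.incl z)) = b₂.incl (ψ z)
    rw [hΦ₁ z, hΦ₀]
    show b₂.incl (ψ₀ (ψ₀.symm (ψ z))) = b₂.incl (ψ z)
    rw [ψ₀.apply_symm_apply]
  -- MarkedReduction: `X` is a double of `W₁`
  have hD : IsDouble b₁ (𝓡 4) X := isDouble_of_extension h₁ h₂ hU hI₁ b₁ b₂ ψ hψ (Φ₁.trans Φ₀) hΦ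
  -- doubles of contractible Stein domains are presentation spheres, hence `S⁴`
  obtain ⟨⟨he⟩, hV⟩ := doubleIsPresentationSphere W₁ J₁ b₁ X hD
  exact stub_presentationSpheres X he hV

end Summit.SmoothPoincare4.SmoothPoincare4.Cruxes.ContractibleTwistedDoubleStandard.LegendrianRKnotRigidity

end

-- h21 skeleton audit: the composition concludes the crux by name; sorries only in the stubs (lead reshape r1: 7 stubs, stub_seam closed)
#h21_check_skeleton "stmt-SmoothPoincare4-3546" Summit.SmoothPoincare4.SmoothPoincare4.Theses.ConvexBisection.ContractibleTwistedDoubleStandard stub_seam stub_fillingUniqueness stub_contactChirality stub_doubleIsHomotopySphere stub_steinTwoHandlebody stub_doubleThickening stub_presentationSpheres
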